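import Mathlib
import HarnessLib

/-!
# Route `ForcedResponseSkewness`, crux `ResponseLocalisation` (stmt-QuantumFields-24869): lattice calculus behind the near-pair laws
# (summation by parts on `ℤ⁴`, reflection oddness, the hyperoctahedral trace identity)

Helper file (`--supports stmt-QuantumFields-24869 --as helper`; route-independent, pure lattice combinatorics) of the width prover
`ym-line-frs-p3` (g5), asked for by the lead `ym-line-frs-p1` g4 (T3 material for the asymptotic-freedom femto stubs of lines
«smeared-femto» / «signed-femto-collar»).  In the RG-improved one-loop model with a frozen-exterior flux background `𝔅 ≍ Φ/depth²`
the exterior-oscillation of the near-pair conditional covariance `kerCov_η(dens(z+w), dens z)` is the cross term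
`𝔅_{μν}𝔅_{ρσ}·⟨δ𝔉_{μν}(w) δ𝔉_{ρσ}(0)⟩ ≍ 𝔅𝔅·∂μ∂ρ D(w)·ḡ²(|w|a)` — ONE propagator, a `d`-wave kernel `Y₂(ŵ)/|w|⁴` that is
conditionally but not absolutely summable over the near ball (lead g3's self-audit 06:12Z, width seats frs-p3 05:52Z / frs-p2 06:07Z).
The three discrete facts that decide what survives are typed here, for finitely supported weights `h` on an additive group (`ℤ⁴`):

* §1 SUMMATION BY PARTS (`finsum_mul_forwardDiff`, `finsum_mul_secondDiff`): `∑ h·∂ₑ⁺F = ∑ (∂ₑ⁻h)·F` with `∂ₑ⁻h(w) = h(w−e) − h(w)`, and the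
  second-order form `∑ h·∂ₑ⁺∂ₑ'⁺G = ∑ (∂ₑ⁻∂ₑ'⁻h)·G` — smearing the near partner against a SMOOTH weight moves both derivatives onto the
  weight (gain `s²‖∂²v‖_∞` per derivative pair, no logarithm), the mechanism of line «smeared-femto»;
* §2 REFLECTION ODDNESS (`finsum_eq_zero_of_odd`, `finsum_mul_mixedCentralDiff_eq_zero`): if `h` and `G` are invariant under an additive
  involution `R` with `R e = −e`, `R e' = e'`, the `h`-weighted sum of the CENTRAL mixed second difference
  `G(w+e+e') − G(w+e−e') − G(w−e+e') + G(w−e−e')` vanishes — the off-diagonal (`μ ≠ ρ`) part of the `d`-wave term dies under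
  reflection-symmetric (e.g. radial) weights;
* §3 PERMUTATION / TRACE IDENTITY (`finsum_mul_secondDiff_eq_of_swap`, `finsum_mul_secondDiff_eq_quarter_laplacian`,
  `finsum_mul_laplacian_eq_neg_of_green`): if `h`, `G` are invariant under an additive map exchanging `e` and `e'`, the diagonal second
  differences along `e` and `e'` have the same `h`-sum; on `ℤ⁴` with full coordinate-permutation symmetry each diagonal sum is `¼` of the
  `h`-sum of the lattice Laplacian `ΔG`, and if `G` is a lattice Green's function on the support of `h` (`ΔG = −δ₀`) that is the pure
  contact term `−h(0)/4` — the mechanism of line «signed-femto-collar» (sphere-by-sphere cancellation of the traceless part, any radial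
  coefficient such as the running `ḡ²(|w|a)` included in `h`).

Nothing here is asserted about Yang–Mills: these are identities for finite sums.  No summit is proved (conditional rung line, leaf R2a
`BalabanLadder.NT`; the YM mass gap is NOT proved).  Refs: lattice Green's function calculus, e.g. Montvay–Münster §1.5; Glimm–Jaffe §9.5.
-/

set_option autoImplicit false

noncomputable section

namespace Summit.QuantumFields.YangMills.Cruxes.ResponseLocalisation.LatticeCalculus

open Function

section Group

variable {V : Type*} [AddCommGroup V]

/-! ## §1 Summation by parts for finitely supported weights -/

/-- A translate of a finitely supported weight is finitely supported. [folklore] -/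
theorem hasFiniteSupport_comp_sub {h : V → ℝ} (hh : h.HasFiniteSupport) (e : V) :
    (fun w => h (w - e)).HasFiniteSupport :=
  hh.comp_of_injective (g := fun w => w - e) sub_left_injective

/-- Translation of a finite sum: `∑ h(w)·F(w+e) = ∑ h(w−e)·F(w)`. [folklore] -/
theorem finsum_mul_shift (h F : V → ℝ) (e : V) :
    ∑ᶠ w, h w * F (w + e) = ∑ᶠ w, h (w - e) * F w := by
  have := finsum_comp_equiv (Equiv.addRight e) (f := fun u => h (u - e) * F u)
  simpa only [Equiv.coe_addRight, add_sub_cancel_right] using this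

/-- **Summation by parts (first order).**  For a finitely supported weight `h`, any `F` and any lattice vector `e`:
`∑ h(w)·(F(w+e) − F(w)) = ∑ (h(w−e) − h(w))·F(w)`. [folklore] -/
theorem finsum_mul_forwardDiff {h : V → ℝ} (hh : h.HasFiniteSupport) (F : V → ℝ) (e : V) :
    ∑ᶠ w, h w * (F (w + e) - F w) = ∑ᶠ w, (h (w - e) - h w) * F w := by
  have h1 : (fun w => h w * F (w + e)).HasFiniteSupport := hh.mul_left _
  have h2 : (fun w => h w * F w).HasFiniteSupport := hh.mul_left _
  have h3 : (fun w => h (w - e) * F w).HasFiniteSupport := (hasFiniteSupport_comp_sub hh e).mul_left _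
  calc ∑ᶠ w, h w * (F (w + e) - F w) = ∑ᶠ w, (h w * F (w + e) - h w * F w) := by simp_rw [mul_sub]
    _ = ∑ᶠ w, h w * F (w + e) - ∑ᶠ w, h w * F w := finsum_sub_distrib h1 h2
    _ = ∑ᶠ w, h (w - e) * F w - ∑ᶠ w, h w * F w := by rw [finsum_mul_shift]
    _ = ∑ᶠ w, (h (w - e) * F w - h w * F w) := (finsum_sub_distrib h3 h2).symm
    _ = ∑ᶠ w, (h (w - e) - h w) * F w := by simp_rw [sub_mul]

/-- **Summation by parts (second order).**  For a finitely supported weight `h`, any `G` and lattice vectors `e, e'`: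
`∑ h(w)·(G(w+e+e') − G(w+e) − G(w+e') + G(w)) = ∑ (h(w−e−e') − h(w−e) − h(w−e') + h(w))·G(w)` — both difference operators move
onto the weight (for a weight `h(w) = v(s·w)` sampled from a smooth `v` the new weight is `O(s²‖∂²v‖_∞)` pointwise). [folklore] -/
theorem finsum_mul_secondDiff {h : V → ℝ} (hh : h.HasFiniteSupport) (G : V → ℝ) (e e' : V) :
    ∑ᶠ w, h w * (G (w + e + e') - G (w + e) - G (w + e') + G w) =
      ∑ᶠ w, (h (w - e - e') - h (w - e) - h (w - e') + h w) * G w := by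
  -- first derivative: `K(u) = G(u + e') − G(u)`
  have step1 := finsum_mul_forwardDiff hh (fun u => G (u + e') - G u) e
  have e1 : ∀ w, h w * (G (w + e + e') - G (w + e) - G (w + e') + G w) =
      h w * ((G (w + e + e') - G (w + e)) - (G (w + e') - G w)) := fun w => by ring
  simp_rw [e1]
  rw [step1]
  -- second derivative on the new weight `h̃(w) = h(w − e) − h(w)`
  have hh' : (fun w => h (w - e) - h w).HasFiniteSupport := (hasFiniteSupport_comp_sub hh e).sub hh
  have step2 := finsum_mul_forwardDiff hh' G e'
  rw [step2]
  refine finsum_congr fun w => ?_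
  have : w - e' - e = w - e - e' := by abel
  rw [this]
  ring

/-! ## §2 Reflection oddness -/

omit [AddCommGroup V] in
/-- A finite sum of a function that is ODD under a bijection of the index set vanishes. [folklore] -/
theorem finsum_eq_zero_of_odd (R : V ≃ V) {f : V → ℝ} (hodd : ∀ w, f (R w) = -f w) : ∑ᶠ w, f w = 0 := by
  have h1 : ∑ᶠ w, f (R w) = ∑ᶠ w, f w := finsum_comp_equiv R
  have h2 : ∑ᶠ w, f (R w) = -∑ᶠ w, f w := by
    simp_rw [hodd]
    exact finsum_neg_distrib _
  linarith

/-- **The off-diagonal `d`-wave term dies under reflection-symmetric weights.**  Let `R` be an additive self-equivalence with `R e = −e`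
and `R e' = e'` (a reflection of the `e`-axis fixing `e'`), and let the weight `h` and the kernel `G` be `R`-invariant.  Then the
`h`-weighted sum of the CENTRAL mixed second difference of `G` along `e, e'` vanishes:
`∑ h(w)·(G(w+e+e') − G(w+e−e') − G(w−e+e') + G(w−e−e')) = 0`. [folklore] -/
theorem finsum_mul_mixedCentralDiff_eq_zero (R : V ≃+ V) {e e' : V} (hRe : R e = -e) (hRe' : R e' = e')
    {h G : V → ℝ} (hh : ∀ w, h (R w) = h w) (hG : ∀ w, G (R w) = G w) :
    ∑ᶠ w, h w * (G (w + e + e') - G (w + e - e') - G (w - e + e') + G (w - e - e')) = 0 := by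
  refine finsum_eq_zero_of_odd R.toEquiv fun w => ?_
  have q1 : R w + e + e' = R (w - e + e') := by rw [map_add, map_sub, hRe, hRe']; abel
  have q2 : R w + e - e' = R (w - e - e') := by rw [map_sub, map_sub, hRe, hRe']; abel
  have q3 : R w - e + e' = R (w + e + e') := by rw [map_add, map_add, hRe, hRe']; abel
  have q4 : R w - e - e' = R (w + e - e') := by rw [map_sub, map_add, hRe, hRe']; abel
  show h (R w) * (G (R w + e + e') - G (R w + e - e') - G (R w - e + e') + G (R w - e - e')) = _
  rw [q1, q2, q3, q4, hh, hG, hG, hG, hG]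
  ring

/-! ## §3 Permutation symmetry and the trace identity -/

/-- **Diagonal second differences along exchangeable directions have equal weighted sums.**  If an additive self-equivalence `P`
maps `e` to `e'` and leaves `h` and `G` invariant, then `∑ h·(G(·+e) − 2G + G(·−e)) = ∑ h·(G(·+e') − 2G + G(·−e'))`. [folklore] -/
theorem finsum_mul_secondDiff_eq_of_swap (P : V ≃+ V) {e e' : V} (hPe : P e = e')
    {h G : V → ℝ} (hh : ∀ w, h (P w) = h w) (hG : ∀ w, G (P w) = G w) :
    ∑ᶠ w, h w * (G (w + e) - 2 * G w + G (w - e)) = ∑ᶠ w, h w * (G (w + e') - 2 * G w + G (w - e')) := by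
  have key := finsum_comp_equiv P.toEquiv (f := fun u => h u * (G (u + e') - 2 * G u + G (u - e')))
  rw [← key]
  refine finsum_congr fun w => ?_
  have q1 : P w + e' = P (w + e) := by rw [map_add, hPe]
  have q2 : P w - e' = P (w - e) := by rw [map_sub, hPe]
  show h w * (G (w + e) - 2 * G w + G (w - e)) = h (P w) * (G (P w + e') - 2 * G (P w) + G (P w - e'))
  rw [q1, q2, hh, hG, hG, hG]

end Group

/-! ### The trace identity on `ℤ⁴` -/

section Z4

/-- Coordinate transposition as an additive self-equivalence of `ℤ⁴` (precomposition with `Equiv.swap`). [folklore] -/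
theorem swap_single (μ ρ : Fin 4) :
    (LinearEquiv.funCongrLeft ℤ ℤ (Equiv.swap μ ρ)) (Pi.single μ (1 : ℤ)) = Pi.single ρ 1 := by
  ext i
  rw [LinearEquiv.funCongrLeft_apply, LinearMap.funLeft_apply]
  by_cases hi : i = ρ
  · subst hi
    rw [Equiv.swap_apply_right, Pi.single_eq_same, Pi.single_eq_same]
  · by_cases hi' : i = μ
    · subst hi'
      rw [Equiv.swap_apply_left, Pi.single_eq_of_ne hi, Pi.single_eq_of_ne (Ne.symm hi)]
    · rw [Equiv.swap_apply_of_ne_of_ne hi' hi, Pi.single_eq_of_ne hi', Pi.single_eq_of_ne hi]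

/-- **Trace identity on `ℤ⁴`.**  For a finitely supported weight `h` and a kernel `G`, both invariant under all coordinate
transpositions, every diagonal second-difference sum is a quarter of the Laplacian sum:
`∑ h(w)·(G(w+e_μ) − 2G(w) + G(w−e_μ)) = ¼ ∑ h(w)·ΔG(w)`, `ΔG(w) = Σ_ν (G(w+e_ν) − 2G(w) + G(w−e_ν))`.  With §2 this is the statement
that a hyperoctahedrally symmetric smearing of a covariant symmetric tensor `∂μ∂ρG` retains only `(δ_{μρ}/4)·ΔG`. [folklore] -/
theorem finsum_mul_secondDiff_eq_quarter_laplacian {h G : (Fin 4 → ℤ) → ℝ} (hh : h.HasFiniteSupport)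
    (hhP : ∀ (μ ρ : Fin 4) (w : Fin 4 → ℤ), h (w ∘ Equiv.swap μ ρ) = h w)
    (hGP : ∀ (μ ρ : Fin 4) (w : Fin 4 → ℤ), G (w ∘ Equiv.swap μ ρ) = G w) (μ : Fin 4) :
    ∑ᶠ w, h w * (G (w + Pi.single μ 1) - 2 * G w + G (w - Pi.single μ 1)) =
      (1 / 4) * ∑ᶠ w, h w * ∑ ν : Fin 4, (G (w + Pi.single ν 1) - 2 * G w + G (w - Pi.single ν 1)) := by
  -- all four directional sums agree
  have hdir : ∀ ν : Fin 4, ∑ᶠ w, h w * (G (w + Pi.single μ 1) - 2 * G w + G (w - Pi.single μ 1)) =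
      ∑ᶠ w, h w * (G (w + Pi.single ν 1) - 2 * G w + G (w - Pi.single ν 1)) := fun ν =>
    finsum_mul_secondDiff_eq_of_swap (LinearEquiv.funCongrLeft ℤ ℤ (Equiv.swap μ ν)).toAddEquiv (swap_single μ ν)
      (fun w => hhP μ ν w) (fun w => hGP μ ν w)
  -- pull the finite direction sum out of the lattice sum
  have hfin : ∀ ν ∈ (Finset.univ : Finset (Fin 4)),
      (fun w => h w * (G (w + Pi.single ν 1) - 2 * G w + G (w - Pi.single ν 1))).HasFiniteSupport := fun ν _ =>
    hh.mul_left _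
  have hsum : ∑ᶠ w, h w * ∑ ν : Fin 4, (G (w + Pi.single ν 1) - 2 * G w + G (w - Pi.single ν 1)) =
      ∑ ν : Fin 4, ∑ᶠ w, h w * (G (w + Pi.single ν 1) - 2 * G w + G (w - Pi.single ν 1)) := by
    simp_rw [Finset.mul_sum]
    exact finsum_sum_comm Finset.univ (fun w ν => h w * (G (w + Pi.single ν 1) - 2 * G w + G (w - Pi.single ν 1))) hfin
  rw [hsum, Finset.sum_congr rfl fun ν _ => (hdir ν).symm, Finset.sum_const, Finset.card_univ, Fintype.card_fin]
  simp only [nsmul_eq_mul, Nat.cast_ofNat]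
  ring

/-- **Contact term.**  If `G` is a lattice Green's function on the support of the weight (`ΔG(w) = −δ_{w,0}` wherever `h(w) ≠ 0`), the
Laplacian sum is the pure contact term: `∑ h·ΔG = −h(0)`. [folklore] -/
theorem finsum_mul_laplacian_eq_neg_of_green {h G : (Fin 4 → ℤ) → ℝ}
    (hgreen : ∀ w, h w ≠ 0 → ∑ ν : Fin 4, (G (w + Pi.single ν 1) - 2 * G w + G (w - Pi.single ν 1)) = if w = 0 then -1 else 0) :
    ∑ᶠ w, h w * ∑ ν : Fin 4, (G (w + Pi.single ν 1) - 2 * G w + G (w - Pi.single ν 1)) = -h 0 := by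
  have heq : (fun w => h w * ∑ ν : Fin 4, (G (w + Pi.single ν 1) - 2 * G w + G (w - Pi.single ν 1))) =
      fun w => if w = 0 then -h 0 else 0 := by
    funext w
    by_cases hw : h w = 0
    · rw [hw, zero_mul]; split_ifs with h0
      · rw [h0] at hw; rw [hw, neg_zero]
      · rfl
    · rw [hgreen w hw]; split_ifs with h0
      · rw [h0]; ring
      · rw [mul_zero]
  rw [heq]
  exact finsum_eq_single _ 0 fun w hw => if_neg hw

end Z4

end Summit.QuantumFields.YangMills.Cruxes.ResponseLocalisation.LatticeCalculus

end
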